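import Summits.RiemannHypothesis.RiemannHypothesis.Theorems.TiltedLandingLaw421R3TouchedGlueHAdapt

/-!
# Glue v5, part 6 — COUNT-CAPPED β RESERVATION (FIT‴) (lens-2 g8, module 41f; director-rh (CA757)(B1), (CA764)(C))

ONE import: part 5 `…R3TouchedGlueHAdapt` (#1213, FIT″).  GLUE only: no new law, no registry move; Γ4's binder `hrest` keeps its TYPE
`ClassLawQ (diffClass ApproachLevelQ (BetaLevelQ κ₀)) aRest`; the conclusion of the canonical converter is the registry's ★A literal.

THE SECOND IDLE RESERVATION.  FIT″ (part 5) debits the FULL β purse `betaPurseWQ cF L F + aT F` (`≈ 0.445·P + aT` at T★, `P = (Hs/s)²`) on every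
legal frame that has at least ONE charged β-level.  But the β books of part 3 charge each level at most ONE unit plus the witness-level drop penalty
(`netCostQ (BetaLevelQ κ₀)` summand `1 − 4·dropQ/s ≤ 1 + dropPenaltyHQ`), and the penalties are already inside Γ3″'s rise allowance `aT`
(`dropPenaltyHQ ≤ touchRiseHQ`, `TouchRiseLawHQ`).  So on a frame with finitely many charged β-levels, `N_β(F)` of them, the β class law ALSO holds with
allowance `N_β(F) + aT F`; the reservation can be CAPPED at `min (betaPurseWQ cF L F) N_β(F) + aT F` (frame-adaptively `0` where there is no charged
β-level, as in part 5).  (The cap is `min(purse, N_β) + aT`, not `min(purse + aT, N_β)`: a witness level with a NEGATIVE drop costs `1 + 4·[−drop]⁺/s`;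
on every bench frame of record the penalty column is `0` — crit-1 CUT 38, Σρ̂_pen = 0 on 11/11 — so the two read the same there.)

WHAT IT TYPES (all (K), 0 sorries).
  §C1 `betaSetQ κ₀ F` (the set of charged β-levels of a frame) and `betaCountCapQ κ₀ aβ` — the COUNT-CAPPED allowance: `min (aβ F) (#betaSetQ κ₀ F)` when
      that set is finite, `aβ F` otherwise (cap void); `betaCountCapQ_le` (never above `aβ`), `betaCountCapQ_le_card`.
  §C2 `netCostQ_beta_le_card_add_penalty` — the β net cost below `k` is at most the number of charged β-levels below `k` plus the penalty prefix;
      `prefixSum_dropPenalty_le_touchRise`; `card_filter_le_betaSet`.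
  §C3 ★ `classLawQ_countCap : ClassLawQ (BetaLevelQ κ₀) (aβ + aT) → TouchRiseLawHQ cF L κ₀ aT → ClassLawQ (BetaLevelQ κ₀) (betaCountCapQ κ₀ aβ + aT)`.
  §C4 ★★ `approachC_of_TH_count` / `…_count_canonical` — the converter with FIT‴ :
      `betaUsedQ κ₀ (betaCountCapQ κ₀ (betaPurseWQ cF L) + aT) F + aRest F ≤ approachBudgetHalfQ aR aC F` per legal frame (canonical: `riseSupQ consSupQ`,
      conclusion `ApproachAllowanceQ (approachBudgetHalfQ riseSupQ consSupQ)` = the registry literal); `fitAdaptive_implies_fitCount`: FIT″ ⟹ FIT‴ on every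
      frame (no sign condition), so part 6 is never weaker than part 5 (nor than #1205).
  §C5 the RESIDUAL-TYPED rest budget `restResidualQ κ₀ cF L aT aA F := aA F − betaUsed‴ F` — a `Budget`, so Γ4's binder KEEPS ITS TYPE with
      `aRest := restResidualQ …`; then the fit is an identity and `approachC_of_TH_count_residual` has NO fit hypothesis; readings `restResidualQ_of_not`
      (no charged β-level ⇒ Γ4 may spend the whole allowance) and `restResidualQ_ge` (N_β charged β-levels ⇒ Γ4 keeps at least `aA F − N_β − aT F`).

NUMBERS OF RECORD (crit-1 CUT 43 corrected column, director (CA764)(A); toy floats INDICATIVE, nothing here is an instance): on the F*β plant row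
(ρ₀ .9, P 12 343: K_tree 1 913 · N_β 41 · cost .1211·P) FIT″ margin 3.20 → FIT‴ 7.08; CLOSED FORM on every untouched-or-single-companion legal design:
FIT‴ margin ≥ (1 − 5ρ₀²/16)/(ρ₀²/4) ≥ 2.75 (N_β + Γ4 cost ≤ K_tree ≤ (1−ε)²ρ₀²P/(8c), c ≥ ½).  The allowance's P-part is `1 − (5/16)ρ₀²`
(`approachBudgetHalf_apply` + `slack0Q_eq`; it TENDS to 11/16 at ρ₀ → 1 — ERRATUM 4 of the lens-2 memos).  What part 6 does NOT do: it does not re-home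
LOOSE approach levels to the far purse (that is the unregistered candidate re-cut `…Cruxes/TiltedLandingLaw421R/Lens2_trkD_v12q_draft.lean`).
Nothing here bears on the truth of RH; RH is not proved; T★ / Γ3″ / Γ4 / FIT″ / FIT‴ are typed OPEN hypotheses; ★A / 33346 / 33347 OPEN;
checked ≠ landed ≠ proved.
-/

namespace RhW08.TouchedGlueHCount

open RhW08.Round1 RhW08.StSwap RhW08.Round2 RhW08.QuadW
open RhW08.SealSwap (PBot)
open RhW08.SealSwapQ RhW08.RateSplit RhW08.BurgersRate RhW08.BurgersRateG3 RhW08.TouchedDissipation RhW08.TouchedDissipationW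
open RhIdea6.G17.W07C7 RhIdea6.G17.W07C7.Rev6 RhIdea6.G18.W07C8.Law421BirthS RhIdea6.G19.W07C11.Seam
open RhIdea6.G20.W07C12.Frac RhIdea6.G20.W07C12.StColP RhW07.C12.FieldSplit RhIdea6.G21.W07C13.TentMax
open RhW07.C14.TwoSided RhW07.C14.Classes RhW07.C14.Lineage RhW07.C14.Booking
open RhW08.TouchedGlueW RhW08.TouchedGlueH RhW08.TouchedGlueHAdapt

/-! ## §C1 the charged-β level set and the count-capped allowance -/

/-- §C1 the CHARGED-β LEVEL SET of a frame: the levels that are charged and lie in the paid β class `BetaLevelQ κ₀`. -/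
def betaSetQ (κ₀ η : ℝ) (f : ℂ → ℂ) (x₀ s hmax R Hs : ℝ) (B : ℕ) : Set ℕ :=
  {k : ℕ | Charged (PTrkSQ PBot) StTrkDQ ReadyR2 η f x₀ s hmax R Hs B k ∧ BetaLevelQ κ₀ η f x₀ s hmax R Hs B k}

/-- (K) §C1 a frame has a charged β-level iff its charged-β level set is non-empty. -/
theorem hasBetaLevelQ_iff_nonempty {κ₀ η : ℝ} {f : ℂ → ℂ} {x₀ s hmax R Hs : ℝ} {B : ℕ} :
    HasBetaLevelQ κ₀ η f x₀ s hmax R Hs B ↔ (betaSetQ κ₀ η f x₀ s hmax R Hs B).Nonempty :=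
  Iff.rfl

open Classical in
/-- §C1 the COUNT-CAPPED β allowance: `min (aβ F) (number of charged β-levels of F)` when the charged-β level set of the frame is finite; the uncapped
`aβ F` otherwise (then the cap is void and nothing is claimed). -/
noncomputable def betaCountCapQ (κ₀ : ℝ) (aβ : Budget) : Budget := fun η f x₀ s hmax R Hs B =>
  if h : (betaSetQ κ₀ η f x₀ s hmax R Hs B).Finite then min (aβ η f x₀ s hmax R Hs B) (h.toFinset.card : ℝ)
  else aβ η f x₀ s hmax R Hs B

/-- (K) §C1 the finite case. -/
theorem betaCountCapQ_of_finite {κ₀ : ℝ} {aβ : Budget} {η : ℝ} {f : ℂ → ℂ} {x₀ s hmax R Hs : ℝ} {B : ℕ}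
    (h : (betaSetQ κ₀ η f x₀ s hmax R Hs B).Finite) :
    betaCountCapQ κ₀ aβ η f x₀ s hmax R Hs B = min (aβ η f x₀ s hmax R Hs B) (h.toFinset.card : ℝ) := by
  unfold betaCountCapQ
  rw [dif_pos h]

/-- (K) §C1 the infinite case: no cap. -/
theorem betaCountCapQ_of_not_finite {κ₀ : ℝ} {aβ : Budget} {η : ℝ} {f : ℂ → ℂ} {x₀ s hmax R Hs : ℝ} {B : ℕ}
    (h : ¬ (betaSetQ κ₀ η f x₀ s hmax R Hs B).Finite) :
    betaCountCapQ κ₀ aβ η f x₀ s hmax R Hs B = aβ η f x₀ s hmax R Hs B := by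
  unfold betaCountCapQ
  rw [dif_neg h]

/-- (K) §C1 the capped allowance never exceeds the uncapped one. -/
theorem betaCountCapQ_le {κ₀ : ℝ} {aβ : Budget} {η : ℝ} {f : ℂ → ℂ} {x₀ s hmax R Hs : ℝ} {B : ℕ} :
    betaCountCapQ κ₀ aβ η f x₀ s hmax R Hs B ≤ aβ η f x₀ s hmax R Hs B := by
  by_cases h : (betaSetQ κ₀ η f x₀ s hmax R Hs B).Finite
  · rw [betaCountCapQ_of_finite h]
    exact min_le_left _ _
  · rw [betaCountCapQ_of_not_finite h]

/-- (K) §C1 the capped allowance never exceeds the number of charged β-levels (finite case). -/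
theorem betaCountCapQ_le_card {κ₀ : ℝ} {aβ : Budget} {η : ℝ} {f : ℂ → ℂ} {x₀ s hmax R Hs : ℝ} {B : ℕ}
    (h : (betaSetQ κ₀ η f x₀ s hmax R Hs B).Finite) :
    betaCountCapQ κ₀ aβ η f x₀ s hmax R Hs B ≤ (h.toFinset.card : ℝ) := by
  rw [betaCountCapQ_of_finite h]
  exact min_le_right _ _

/-! ## §C2 the count bound on the β books -/

open Classical in
/-- (K) §C2 the β NET COST below `k` is at most the NUMBER of charged β-levels below `k` plus the penalty prefix: per level the books' summand
`1 − 4·dropQ/s` is `≤ 1 + 4·[−dropQ]⁺/s = 1 + dropPenaltyHQ` at a witness level and `0 ≤ dropPenaltyHQ` elsewhere. -/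
theorem netCostQ_beta_le_card_add_penalty (κ₀ η : ℝ) (f : ℂ → ℂ) (x₀ : ℝ) {s : ℝ} (hmax R Hs : ℝ) (B : ℕ) (hs : 0 ≤ s) (k : ℕ) :
    netCostQ (BetaLevelQ κ₀) η f x₀ s hmax R Hs B k
      ≤ (((Finset.range k).filter (fun j => Charged (PTrkSQ PBot) StTrkDQ ReadyR2 η f x₀ s hmax R Hs B j
            ∧ BetaLevelQ κ₀ η f x₀ s hmax R Hs B j)).card : ℝ)
        + prefixSumQ (dropPenaltyHQ κ₀) η f x₀ s hmax R Hs B k := by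
  unfold netCostQ prefixSumQ
  rw [Finset.card_filter, Nat.cast_sum, ← Finset.sum_add_distrib]
  refine Finset.sum_le_sum fun j _ => ?_
  by_cases hj : Charged (PTrkSQ PBot) StTrkDQ ReadyR2 η f x₀ s hmax R Hs B j ∧ BetaLevelQ κ₀ η f x₀ s hmax R Hs B j
  · simp only [if_pos hj, Nat.cast_one, dropPenaltyHQ_of_witness (betaWitness_iff.2 hj)]
    have hdrop : -(4 * dropQ η f x₀ s hmax R Hs B j / s) ≤ 4 * max (-dropQ η f x₀ s hmax R Hs B j) 0 / s := by
      rw [← neg_div, ← mul_neg]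
      exact div_le_div_of_nonneg_right (mul_le_mul_of_nonneg_left (le_max_left _ _) (by norm_num)) hs
    linarith
  · simp only [if_neg hj, Nat.cast_zero, zero_add]
    exact dropPenaltyHQ_nonneg κ₀ η f x₀ hmax R Hs B j hs

/-- (K) §C2 the penalty prefix is within the rise meter's prefix (`touchRiseHQ = [rise]⁺ + dropPenaltyHQ`, the first term `≥ 0`). -/
theorem prefixSum_dropPenalty_le_touchRise (cF : Budget) (L κ₀ η : ℝ) (f : ℂ → ℂ) (x₀ s hmax R Hs : ℝ) (B k : ℕ) :
    prefixSumQ (dropPenaltyHQ κ₀) η f x₀ s hmax R Hs B k ≤ prefixSumQ (touchRiseHQ cF L κ₀) η f x₀ s hmax R Hs B k := by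
  unfold prefixSumQ touchRiseHQ
  refine Finset.sum_le_sum fun j _ => ?_
  exact le_add_of_nonneg_left (le_max_right _ _)

open Classical in
/-- (K) §C2 the charged β-levels below any prefix are among the frame's charged β-levels (finite case: a card inequality). -/
theorem card_filter_le_betaSet {κ₀ η : ℝ} {f : ℂ → ℂ} {x₀ s hmax R Hs : ℝ} {B : ℕ} (h : (betaSetQ κ₀ η f x₀ s hmax R Hs B).Finite) (k : ℕ) :
    ((Finset.range k).filter (fun j => Charged (PTrkSQ PBot) StTrkDQ ReadyR2 η f x₀ s hmax R Hs B j
        ∧ BetaLevelQ κ₀ η f x₀ s hmax R Hs B j)).card ≤ h.toFinset.card := by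
  refine Finset.card_le_card fun j hj => ?_
  rw [Finset.mem_filter] at hj
  exact h.mem_toFinset.2 hj.2

/-! ## §C3 ★ the count-capped β class law -/

open Classical in
/-- ★ (K) §C3 **COUNT-CAP SHARPENING**: a β class law with allowance `aβ + aT` TOGETHER with Γ3″ (`TouchRiseLawHQ cF L κ₀ aT`, which books the witness-level
drop penalties) holds with the count-capped allowance `betaCountCapQ κ₀ aβ + aT`: on a frame with finitely many charged β-levels the β net cost up to any
charged level is at most their number plus the penalty prefix `≤ aT F`; on any other frame the cap is void. -/
theorem classLawQ_countCap {cF : Budget} {L κ₀ : ℝ} {aβ aT : Budget} (hβ : ClassLawQ (BetaLevelQ κ₀) (addBudget aβ aT))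
    (hrise : TouchRiseLawHQ cF L κ₀ aT) : ClassLawQ (BetaLevelQ κ₀) (addBudget (betaCountCapQ κ₀ aβ) aT) := by
  intro η f x₀ s hmax R Hs B hE k hk
  have hs : 0 < s := hE.2.2.2.1
  have h1 := hβ η f x₀ s hmax R Hs B hE k hk
  simp only [addBudget] at h1 ⊢
  by_cases hfin : (betaSetQ κ₀ η f x₀ s hmax R Hs B).Finite
  · rw [betaCountCapQ_of_finite hfin]
    have hc := netCostQ_beta_le_card_add_penalty κ₀ η f x₀ hmax R Hs B hs.le (k + 1)
    have hcard : (((Finset.range (k + 1)).filter (fun j => Charged (PTrkSQ PBot) StTrkDQ ReadyR2 η f x₀ s hmax R Hs B j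
        ∧ BetaLevelQ κ₀ η f x₀ s hmax R Hs B j)).card : ℝ) ≤ (hfin.toFinset.card : ℝ) := by
      exact_mod_cast card_filter_le_betaSet hfin (k + 1)
    have hpen : prefixSumQ (dropPenaltyHQ κ₀) η f x₀ s hmax R Hs B (k + 1) ≤ aT η f x₀ s hmax R Hs B :=
      (prefixSum_dropPenalty_le_touchRise cF L κ₀ η f x₀ s hmax R Hs B (k + 1)).trans (hrise η f x₀ s hmax R Hs B hE k hk)
    rcases le_total (aβ η f x₀ s hmax R Hs B) (hfin.toFinset.card : ℝ) with hle | hle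
    · rw [min_eq_left hle]
      exact h1
    · rw [min_eq_right hle]
      linarith
  · rw [betaCountCapQ_of_not_finite hfin]
    exact h1

/-! ## §C4 ★★ the converter with the count-capped frame-adaptive fit (FIT‴) -/

/-- ★ (K) §C4 W(cF) + Γ3″ ⟹ the β CLASS LAW with the count-capped frame-adaptive allowance `betaUsedQ κ₀ (betaCountCapQ κ₀ (betaPurseWQ cF L) + aT)`
(part 3's `betaClassLaw_of_TH`, then §C3, then part 5's `classLawQ_betaUsed`). -/
theorem betaClassLaw_of_TH_count {cF : Budget} {L κ₀ : ℝ} {aT : Budget}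
    (hcF : ∀ (η : ℝ) (f : ℂ → ℂ) (x₀ s hmax R Hs : ℝ) (B : ℕ), EngineHyps5 2 η f x₀ s hmax R Hs B → 0 < cF η f x₀ s hmax R Hs B)
    (hL : 0 ≤ L) (hT : TouchedDissipationLawWQ cF L κ₀) (hrise : TouchRiseLawHQ cF L κ₀ aT) :
    ClassLawQ (BetaLevelQ κ₀) (betaUsedQ κ₀ (addBudget (betaCountCapQ κ₀ (betaPurseWQ cF L)) aT)) :=
  classLawQ_betaUsed (classLawQ_countCap (betaClassLaw_of_TH hcF hL hT hrise) hrise)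

/-- ★★ (K, modulo the NAMED hypotheses) §C4 **THE GLUE v5 / rev 7.3 (count-capped frame-adaptive fit)**: W(cF) with `cF > 0` on legal frames + (Γ3″) rise
allowance + (Γ4) the rest of the approach class + FIT‴ (the β purse reserved only on frames with a charged β-level, and CAPPED by their number when finite)
⟹ `ApproachAllowanceQ (approachBudgetHalfQ aR aC)` for ANY budgets `aR aC`. -/
theorem approachC_of_TH_count {cF : Budget} {L κ₀ : ℝ} {aT aRest aR aC : Budget}
    (hcF : ∀ (η : ℝ) (f : ℂ → ℂ) (x₀ s hmax R Hs : ℝ) (B : ℕ), EngineHyps5 2 η f x₀ s hmax R Hs B → 0 < cF η f x₀ s hmax R Hs B)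
    (hL : 0 ≤ L) (hT : TouchedDissipationLawWQ cF L κ₀) (hrise : TouchRiseLawHQ cF L κ₀ aT)
    (hrest : ClassLawQ (diffClass ApproachLevelQ (BetaLevelQ κ₀)) aRest)
    (hfit : ∀ (η : ℝ) (f : ℂ → ℂ) (x₀ s hmax R Hs : ℝ) (B : ℕ), EngineHyps5 2 η f x₀ s hmax R Hs B →
      betaUsedQ κ₀ (addBudget (betaCountCapQ κ₀ (betaPurseWQ cF L)) aT) η f x₀ s hmax R Hs B + aRest η f x₀ s hmax R Hs B
        ≤ approachBudgetHalfQ aR aC η f x₀ s hmax R Hs B) :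
    ApproachAllowanceQ (approachBudgetHalfQ aR aC) :=
  classLawQ_mono (approachAllowanceQ_of_beta_rest (betaClassLaw_of_TH_count hcF hL hT hrise) hrest)
    (fun η f x₀ s hmax R Hs B hE => by
      show betaUsedQ κ₀ (addBudget (betaCountCapQ κ₀ (betaPurseWQ cF L)) aT) η f x₀ s hmax R Hs B + aRest η f x₀ s hmax R Hs B ≤ _
      exact hfit η f x₀ s hmax R Hs B hE)

/-- ★★ (K) §C4 the CANONICAL instance — literally the registry's `stub_approachC` conclusion `ApproachAllowanceQ (approachBudgetHalfQ riseSupQ consSupQ)`. -/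
theorem approachC_of_TH_count_canonical {cF : Budget} {L κ₀ : ℝ} {aT aRest : Budget}
    (hcF : ∀ (η : ℝ) (f : ℂ → ℂ) (x₀ s hmax R Hs : ℝ) (B : ℕ), EngineHyps5 2 η f x₀ s hmax R Hs B → 0 < cF η f x₀ s hmax R Hs B)
    (hL : 0 ≤ L) (hT : TouchedDissipationLawWQ cF L κ₀) (hrise : TouchRiseLawHQ cF L κ₀ aT)
    (hrest : ClassLawQ (diffClass ApproachLevelQ (BetaLevelQ κ₀)) aRest)
    (hfit : ∀ (η : ℝ) (f : ℂ → ℂ) (x₀ s hmax R Hs : ℝ) (B : ℕ), EngineHyps5 2 η f x₀ s hmax R Hs B →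
      betaUsedQ κ₀ (addBudget (betaCountCapQ κ₀ (betaPurseWQ cF L)) aT) η f x₀ s hmax R Hs B + aRest η f x₀ s hmax R Hs B
        ≤ approachBudgetHalfQ riseSupQ consSupQ η f x₀ s hmax R Hs B) :
    ApproachAllowanceQ (approachBudgetHalfQ riseSupQ consSupQ) :=
  approachC_of_TH_count hcF hL hT hrise hrest hfit

/-- (K) §C4 the count-capped adaptive debit never exceeds the adaptive debit of part 5 (pointwise, on every frame, no sign condition). -/
theorem betaUsedQ_countCap_le {κ₀ : ℝ} {aβ aT : Budget} {η : ℝ} {f : ℂ → ℂ} {x₀ s hmax R Hs : ℝ} {B : ℕ} :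
    betaUsedQ κ₀ (addBudget (betaCountCapQ κ₀ aβ) aT) η f x₀ s hmax R Hs B ≤ betaUsedQ κ₀ (addBudget aβ aT) η f x₀ s hmax R Hs B := by
  by_cases h : HasBetaLevelQ κ₀ η f x₀ s hmax R Hs B
  · rw [betaUsedQ_of_has h, betaUsedQ_of_has h]
    simp only [addBudget]
    have hle := betaCountCapQ_le (κ₀ := κ₀) (aβ := aβ) (η := η) (f := f) (x₀ := x₀) (s := s) (hmax := hmax) (R := R) (Hs := Hs) (B := B)
    linarith
  · rw [betaUsedQ_of_not h, betaUsedQ_of_not h]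

/-- (K) §C4 FIT″ ⟹ FIT‴ against ANY allowance `aA`: the count-capped converter is never weaker than part 5's `approachC_of_TH_adaptive`
(hence, by `fitW_implies_fitAdaptive`, never weaker than #1205's either). -/
theorem fitAdaptive_implies_fitCount {cF : Budget} {L κ₀ : ℝ} {aT aRest aA : Budget}
    (hfit : ∀ (η : ℝ) (f : ℂ → ℂ) (x₀ s hmax R Hs : ℝ) (B : ℕ), EngineHyps5 2 η f x₀ s hmax R Hs B →
      betaUsedQ κ₀ (addBudget (betaPurseWQ cF L) aT) η f x₀ s hmax R Hs B + aRest η f x₀ s hmax R Hs B ≤ aA η f x₀ s hmax R Hs B) :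
    ∀ (η : ℝ) (f : ℂ → ℂ) (x₀ s hmax R Hs : ℝ) (B : ℕ), EngineHyps5 2 η f x₀ s hmax R Hs B →
      betaUsedQ κ₀ (addBudget (betaCountCapQ κ₀ (betaPurseWQ cF L)) aT) η f x₀ s hmax R Hs B + aRest η f x₀ s hmax R Hs B
        ≤ aA η f x₀ s hmax R Hs B := by
  intro η f x₀ s hmax R Hs B hE
  have hle := betaUsedQ_countCap_le (κ₀ := κ₀) (aβ := betaPurseWQ cF L) (aT := aT) (η := η) (f := f) (x₀ := x₀) (s := s)
    (hmax := hmax) (R := R) (Hs := Hs) (B := B)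
  linarith [hfit η f x₀ s hmax R Hs B hE]

/-! ## §C5 the residual-typed rest budget (Γ4's binder keeps its type; the fit becomes an identity) -/

/-- §C5 the RESIDUAL REST BUDGET: the allowance `aA` minus the count-capped frame-adaptive β debit — a `Budget` (a function of the frame datum only), so
Γ4 may be stated as `ClassLawQ (diffClass ApproachLevelQ (BetaLevelQ κ₀)) (restResidualQ κ₀ cF L aT aA)` with its TYPE unchanged. -/
noncomputable def restResidualQ (κ₀ : ℝ) (cF : Budget) (L : ℝ) (aT aA : Budget) : Budget := fun η f x₀ s hmax R Hs B =>
  aA η f x₀ s hmax R Hs B - betaUsedQ κ₀ (addBudget (betaCountCapQ κ₀ (betaPurseWQ cF L)) aT) η f x₀ s hmax R Hs B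

/-- (K) §C5 with the residual rest budget FIT‴ is an identity (on every frame). -/
theorem fitCount_residual (κ₀ : ℝ) (cF : Budget) (L : ℝ) (aT aA : Budget) (η : ℝ) (f : ℂ → ℂ) (x₀ s hmax R Hs : ℝ) (B : ℕ) :
    betaUsedQ κ₀ (addBudget (betaCountCapQ κ₀ (betaPurseWQ cF L)) aT) η f x₀ s hmax R Hs B + restResidualQ κ₀ cF L aT aA η f x₀ s hmax R Hs B
      ≤ aA η f x₀ s hmax R Hs B := by
  unfold restResidualQ
  linarith

/-- ★★ (K, modulo the NAMED hypotheses) §C5 **THE GLUE with Γ4 RESIDUAL-TYPED**: W(cF) + Γ3″ + Γ4 stated against `restResidualQ κ₀ cF L aT (approachBudgetHalfQ aR aC)`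
⟹ `ApproachAllowanceQ (approachBudgetHalfQ aR aC)` — NO fit hypothesis. -/
theorem approachC_of_TH_count_residual {cF : Budget} {L κ₀ : ℝ} {aT aR aC : Budget}
    (hcF : ∀ (η : ℝ) (f : ℂ → ℂ) (x₀ s hmax R Hs : ℝ) (B : ℕ), EngineHyps5 2 η f x₀ s hmax R Hs B → 0 < cF η f x₀ s hmax R Hs B)
    (hL : 0 ≤ L) (hT : TouchedDissipationLawWQ cF L κ₀) (hrise : TouchRiseLawHQ cF L κ₀ aT)
    (hrest : ClassLawQ (diffClass ApproachLevelQ (BetaLevelQ κ₀)) (restResidualQ κ₀ cF L aT (approachBudgetHalfQ aR aC))) :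
    ApproachAllowanceQ (approachBudgetHalfQ aR aC) :=
  approachC_of_TH_count hcF hL hT hrise hrest (fun η f x₀ s hmax R Hs B _ => fitCount_residual κ₀ cF L aT _ η f x₀ s hmax R Hs B)

/-- (K) §C5 READING on a frame WITHOUT a charged β-level (crit-1's F*): Γ4 may spend the whole allowance. -/
theorem restResidualQ_of_not {κ₀ : ℝ} {cF : Budget} {L : ℝ} {aT aA : Budget} {η : ℝ} {f : ℂ → ℂ} {x₀ s hmax R Hs : ℝ} {B : ℕ}
    (h : ¬ HasBetaLevelQ κ₀ η f x₀ s hmax R Hs B) : restResidualQ κ₀ cF L aT aA η f x₀ s hmax R Hs B = aA η f x₀ s hmax R Hs B := by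
  unfold restResidualQ
  rw [betaUsedQ_of_not h, sub_zero]

/-- (K) §C5 READING on a frame WITH charged β-levels, finitely many, `N_β` of them (instr-1's F*β rows): Γ4 keeps at least `aA F − N_β − aT F`. -/
theorem restResidualQ_ge {κ₀ : ℝ} {cF : Budget} {L : ℝ} {aT aA : Budget} {η : ℝ} {f : ℂ → ℂ} {x₀ s hmax R Hs : ℝ} {B : ℕ}
    (h : HasBetaLevelQ κ₀ η f x₀ s hmax R Hs B) (hfin : (betaSetQ κ₀ η f x₀ s hmax R Hs B).Finite) :
    aA η f x₀ s hmax R Hs B - (hfin.toFinset.card : ℝ) - aT η f x₀ s hmax R Hs B ≤ restResidualQ κ₀ cF L aT aA η f x₀ s hmax R Hs B := by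
  unfold restResidualQ
  rw [betaUsedQ_of_has h]
  simp only [addBudget]
  have hle := betaCountCapQ_le_card (aβ := betaPurseWQ cF L) hfin
  linarith

end RhW08.TouchedGlueHCount
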